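import Summits.QuantumFields.YangMills.Theorems.BalabanUVNodesPortU8LiftGeometry

/-!
# PORT PT-B (U8), g3 file 4 — THE NO-WRAP WINDOW AND ITS BLOCKS IN INTEGER COORDINATES: window membership = `|z − z₀|_∞ ≤ R` on centred labels, the centred lift
# preserves ∕ exhausts the window, fine labels over no-reach blocks are centred (with a block of margin to spare), and the lift carries `B^{k+1}(y)` ONTO `B^{k+1}(lift y)`
# — the second geometric half of the (R4ᴰ-Loc) TRANSPORT lemma

Cell `ym-nodeO-ideate` ∕ `ym-balaban-port`, porter `ymgap-nodeO-port-PTB-1` (gen 3), item **stmt-QuantumFields-27931** `BalabanUVNodes.PortPieceLocalityU8`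
(text ⁷⁗ «v10-Loc» `d796c7a1386a82f1`; residue after ✓SkeletonV11 = the window transport identity `hT`).  `--supports stmt-QuantumFields-27931` (helper).
[I] = [Balaban1987RG1], [B6] = [Balaban1984PropagatorsII].

WHAT THIS FILE PROVES (theorems only; no `def ∕ instance ∕ notation ∕ sorry`; standard axioms): §4 `min_val_sub_eq_natAbs_valMinAbs` (torus distance = `|vma(a − b)|`),
★ `mem_windowSites_siteOfInt_iff` ∕ `mem_recordWindow_siteOfInt_iff` (no-reach radius `2(|z₀ i| + R) < N`: `Φ w ∈ window ↔ |w − z₀|_∞ ≤ R` for `2|w| ≤ N`), `NoWrapAt.two_mul_lt`,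
`NoWrapAt.succ_vol`, ★ `liftSiteCtr_mem_recordWindow_iff`, ★ `exists_lift_of_mem_recordWindow_succ` (the lifted window is the image of the window); §5
`sitesPerDir_zero_eq_pow_mul`, `abs_ediv_le_of_abs_le`, `two_mul_abs_ediv_pow_le`, `two_mul_abs_lt_of_ediv_eq` ∕ `'` (fine labels over no-reach blocks are centred, with a block of
slack), ★★ `image_liftSiteCtr_iterBlock` (`lift '' B^{k+1}(y) = B^{k+1}(lift y)` for `y` in a no-reach cube).
HONEST FRAMING.  Lattice bookkeeping; nothing of Bałaban asserted∕ported∕discharged; 27931 OPEN · SIGNED v10-Loc · close HOLD (№495); K0⁷ OPEN; NODE O 0∕1; COUNT 8∕28 · K 1∕4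
UNMOVED; finite `𝕋⁴_{L^K}` at fixed ε — NOT continuum ∕ OS ∕ Clay; **the Yang–Mills mass gap (Clay) is NOT proved by any of this.**
-/

noncomputable section

namespace Summit.QuantumFields.YangMills.Theorems.PortU8

open Literature.MathematicalPhysics.QuantumFieldTheory.Balaban1983to89
open Literature.MathematicalPhysics.QuantumFieldTheory.Balaban1983to89.Node00
open Literature.MathematicalPhysics.QuantumFieldTheory.Balaban1983to89.T4Continuum (T4Family)
open Literature.MathematicalPhysics.QuantumFieldTheory.Balaban1983to89.B5Eq118OneStroke (iterBlockOf iterBlock)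
open Literature.MathematicalPhysics.QuantumFieldTheory.Balaban1983to89.LatticeFieldCalculus (runSite)
open Summit.QuantumFields.YangMills.Theorems.K0RecordFormatNames

variable (F : T4Family)

/-! ## §4  The no-wrap window in integer coordinates -/

/-- The torus distance of two residues is the absolute value of the least-absolute-value residue of their difference. [folklore] -/
theorem min_val_sub_eq_natAbs_valMinAbs {n : ℕ} [NeZero n] (a b : ZMod n) : min (a - b).val (b - a).val = (a - b).valMinAbs.natAbs := by
  rw [ZMod.valMinAbs_natAbs_eq_min, show b - a = -(a - b) by ring, ZMod.neg_val]
  split_ifs with h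
  · rw [h, ZMod.val_zero]; simp
  · rfl

/-- **WINDOW MEMBERSHIP IN INTEGER COORDINATES**: if the cube of radius `R` about the centre label `c` does not reach the antipodal layer (`2(|c_i| + R) < N`), then for a label
`w` with `2|w_i| ≤ N` the site `Φ w` lies in `windowSites R (Φ c)` iff `|w_i − c_i| ≤ R` for every `i`. [cite: Balaban1987RG1, (1.21) p.264, p.274 L8–9 (bookkeeping)] -/
theorem mem_windowSites_siteOfInt_iff (k K R : ℕ) (c w : Fin 4 → ℤ) (hc : ∀ i, 2 * (|c i| + R) < ((F.P K).sitesPerDir (k + 1) : ℤ))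
    (hw : ∀ i, 2 * |w i| ≤ ((F.P K).sitesPerDir (k + 1) : ℤ)) :
    siteOfInt F K (k + 1) w ∈ windowSites F k K R (siteOfInt F K (k + 1) c) ↔ ∀ i, |w i - c i| ≤ R := by
  haveI : NeZero ((F.P K).sitesPerDir (k + 1)) := ⟨(F.P K).sitesPerDir_ne_zero (k + 1)⟩
  set N := (F.P K).sitesPerDir (k + 1) with hN
  simp only [windowSites, Finset.mem_filter, Finset.mem_univ, true_and]
  have hdiff : ∀ μ : Fin (F.P K).d, siteOfInt F K (k + 1) w μ - siteOfInt F K (k + 1) c μ = (((w (Fin.cast (F.P_d K) μ) - c (Fin.cast (F.P_d K) μ) : ℤ)) : ZMod N) := by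
    intro μ; rw [siteOfInt_apply, siteOfInt_apply]; push_cast; rfl
  have key : ∀ μ : Fin (F.P K).d, min (siteOfInt F K (k + 1) w μ - siteOfInt F K (k + 1) c μ).val (siteOfInt F K (k + 1) c μ - siteOfInt F K (k + 1) w μ).val ≤ R ↔
      |w (Fin.cast (F.P_d K) μ) - c (Fin.cast (F.P_d K) μ)| ≤ R := by
    intro μ
    set i := Fin.cast (F.P_d K) μ
    rw [min_val_sub_eq_natAbs_valMinAbs, hdiff μ]
    set v := ((((w i - c i : ℤ)) : ZMod N)).valMinAbs with hv
    have hvspec := (ZMod.valMinAbs_spec (((w i - c i : ℤ)) : ZMod N) v).1 rfl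
    -- `v ≡ w i - c i (mod N)` and `v` is centred
    have hmod : ((v : ℤ) : ZMod N) = (((w i - c i : ℤ)) : ZMod N) := by rw [hv, ZMod.coe_valMinAbs]
    rw [ZMod.intCast_eq_intCast_iff, Int.modEq_iff_dvd] at hmod
    obtain ⟨t, ht⟩ := hmod
    have hwi := hw i; have hci := hc i
    have hR0 : (0 : ℤ) ≤ R := Nat.cast_nonneg _
    constructor
    · intro h
      have hv' : |v| ≤ R := by
        have : (v.natAbs : ℤ) ≤ R := by exact_mod_cast h
        rwa [Int.natCast_natAbs] at this
      -- if `t ≠ 0` the difference would be at least `N - R`, impossible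
      by_cases ht0 : t = 0
      · rw [ht0, mul_zero, sub_eq_zero] at ht; rw [ht]; exact hv'
      · exfalso
        have h1 : |w i - c i - v| = (N : ℤ) * |t| := by rw [ht, abs_mul, Nat.abs_cast]
        have h2 : (N : ℤ) ≤ (N : ℤ) * |t| := le_mul_of_one_le_right (Nat.cast_nonneg _) (Int.one_le_abs ht0)
        have h3 : |w i - c i - v| ≤ |w i| + |c i| + |v| := by
          calc |w i - c i - v| ≤ |w i - c i| + |v| := abs_sub _ _
            _ ≤ |w i| + |c i| + |v| := by linarith [abs_sub (w i) (c i)]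
        nlinarith
    · intro h
      -- `w i - c i` is itself centred, so it IS the least-absolute-value residue
      have hcen : (w i - c i) * 2 ∈ Set.Ioc (-(N : ℤ)) N := by
        have : 2 * |w i - c i| < N := by
          have := abs_nonneg (c i); nlinarith
        exact mem_Ioc_of_two_mul_abs_lt this
      have hveq : v = w i - c i := by rw [hv]; exact (ZMod.valMinAbs_spec _ _).2 ⟨rfl, hcen⟩
      have : (v.natAbs : ℤ) ≤ R := by rw [Int.natCast_natAbs, hveq]; exact h
      exact_mod_cast this
  constructor
  · intro h i
    have := (key (Fin.cast (F.P_d K).symm i)).1 (h _)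
    have hc' : Fin.cast (F.P_d K) (Fin.cast (F.P_d K).symm i) = i := Fin.ext rfl
    rwa [hc'] at this
  · intro h μ
    exact (key μ).2 (h _)

/-- The same for the record's window `recordWindow F k K R z₀ = windowSites R (Φ z₀)`. [cite: Balaban1987RG1, (1.21) p.264 (bookkeeping)] -/
theorem mem_recordWindow_siteOfInt_iff (k K R : ℕ) (z₀ w : Fin 4 → ℤ) (hc : ∀ i, 2 * (|z₀ i| + R) < ((F.P K).sitesPerDir (k + 1) : ℤ))
    (hw : ∀ i, 2 * |w i| ≤ ((F.P K).sitesPerDir (k + 1) : ℤ)) :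
    siteOfInt F K (k + 1) w ∈ recordWindow F k K R z₀ ↔ ∀ i, |w i - z₀ i| ≤ R :=
  mem_windowSites_siteOfInt_iff F k K R z₀ w hc hw

/-- `NoWrapAt F k K R z₀` gives the no-reach hypothesis `2(|z₀ i| + R′) < N_{k+1}(K)` for every `R′ ≤ R + 1`. [cite: Balaban1987RG1, (1.21) p.264 (bookkeeping)] -/
theorem NoWrapAt.two_mul_lt {k K R : ℕ} {z₀ : Fin 4 → ℤ} (h : NoWrapAt F k K R z₀) {R' : ℕ} (hR : R' ≤ R + 1) (i : Fin 4) :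
    2 * (|z₀ i| + R') < ((F.P K).sitesPerDir (k + 1) : ℤ) := by
  have := h i
  have hR' : (R' : ℤ) ≤ R + 1 := by exact_mod_cast hR
  linarith

/-- `NoWrapAt` is inherited by the bigger torus. [cite: Balaban1987RG1, (1.21) p.264 (bookkeeping)] -/
theorem NoWrapAt.succ_vol {k K R : ℕ} {z₀ : Fin 4 → ℤ} (h : NoWrapAt F k K R z₀) (hk : k + 1 ≤ F.m + K) : NoWrapAt F k (K + 1) R z₀ := by
  intro μ
  have := h (Fin.cast (F.P_d K).symm (Fin.cast (F.P_d (K + 1)) μ))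
  have hle : ((F.P K).sitesPerDir (k + 1) : ℤ) ≤ (F.P (K + 1)).sitesPerDir (k + 1) := by exact_mod_cast sitesPerDir_le_succ_vol F K (k + 1) hk
  exact lt_of_lt_of_le this hle

/-- The least-absolute-value coordinates satisfy `2|vma| ≤ N`. [folklore] -/
theorem two_mul_abs_valMinAbs_le (K j : ℕ) (x : Site (F.P K) j) (μ : Fin (F.P K).d) :
    2 * |((x μ).valMinAbs : ℤ)| ≤ ((F.P K).sitesPerDir j : ℤ) := by
  have h := valMinAbs_mem_Ioc' F K j x μ
  rcases le_or_gt 0 ((x μ).valMinAbs : ℤ) with hv | hv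
  · rw [abs_of_nonneg hv]; linarith [h.2]
  · rw [abs_of_neg hv]; linarith [h.1]

/-- ★ **THE CENTRED LIFT PRESERVES WINDOW MEMBERSHIP** (no-reach radius): `lift y ∈ recordWindow (K+1) R z₀ ↔ y ∈ recordWindow K R z₀`.
[cite: Balaban1987RG1, (1.21) p.264] -/
theorem liftSiteCtr_mem_recordWindow_iff (k K R : ℕ) (hk : k + 1 ≤ F.m + K) (z₀ : Fin 4 → ℤ)
    (hc : ∀ i, 2 * (|z₀ i| + R) < ((F.P K).sitesPerDir (k + 1) : ℤ)) (y : Site (F.P K) (k + 1)) :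
    liftSiteCtr F K (k + 1) y ∈ recordWindow F k (K + 1) R z₀ ↔ y ∈ recordWindow F k K R z₀ := by
  have hle : ((F.P K).sitesPerDir (k + 1) : ℤ) ≤ (F.P (K + 1)).sitesPerDir (k + 1) := by exact_mod_cast sitesPerDir_le_succ_vol F K (k + 1) hk
  have hc' : ∀ i, 2 * (|z₀ i| + R) < ((F.P (K + 1)).sitesPerDir (k + 1) : ℤ) := fun i => lt_of_lt_of_le (hc i) hle
  set w : Fin 4 → ℤ := fun i => ((y (Fin.cast (F.P_d K).symm i)).valMinAbs : ℤ) with hw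
  have hw2 : ∀ i, 2 * |w i| ≤ ((F.P K).sitesPerDir (k + 1) : ℤ) := fun i => two_mul_abs_valMinAbs_le F K (k + 1) y _
  have hw2' : ∀ i, 2 * |w i| ≤ ((F.P (K + 1)).sitesPerDir (k + 1) : ℤ) := fun i => (hw2 i).trans hle
  rw [liftSiteCtr_eq_siteOfInt, mem_recordWindow_siteOfInt_iff F k (K + 1) R z₀ w hc' hw2']
  conv_rhs => rw [← siteOfInt_valMinAbs F K (k + 1) y]
  rw [mem_recordWindow_siteOfInt_iff F k K R z₀ w hc hw2]

/-- ★ **THE LIFTED WINDOW IS THE IMAGE OF THE WINDOW**: every site of `recordWindow (K+1) R z₀` is the centred lift of a site of `recordWindow K R z₀` (no-reach radius).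
[cite: Balaban1987RG1, (1.21) p.264] -/
theorem exists_lift_of_mem_recordWindow_succ (k K R : ℕ) (hk : k + 1 ≤ F.m + K) (z₀ : Fin 4 → ℤ)
    (hc : ∀ i, 2 * (|z₀ i| + R) < ((F.P K).sitesPerDir (k + 1) : ℤ)) {y' : Site (F.P (K + 1)) (k + 1)} (hy' : y' ∈ recordWindow F k (K + 1) R z₀) :
    ∃ y : Site (F.P K) (k + 1), y ∈ recordWindow F k K R z₀ ∧ liftSiteCtr F K (k + 1) y = y' := by
  have hle : ((F.P K).sitesPerDir (k + 1) : ℤ) ≤ (F.P (K + 1)).sitesPerDir (k + 1) := by exact_mod_cast sitesPerDir_le_succ_vol F K (k + 1) hk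
  have hc' : ∀ i, 2 * (|z₀ i| + R) < ((F.P (K + 1)).sitesPerDir (k + 1) : ℤ) := fun i => lt_of_lt_of_le (hc i) hle
  set w : Fin 4 → ℤ := fun i => ((y' (Fin.cast (F.P_d (K + 1)).symm i)).valMinAbs : ℤ) with hw
  have hw2' : ∀ i, 2 * |w i| ≤ ((F.P (K + 1)).sitesPerDir (k + 1) : ℤ) := fun i => two_mul_abs_valMinAbs_le F (K + 1) (k + 1) y' _
  have hy'w : siteOfInt F (K + 1) (k + 1) w = y' := siteOfInt_valMinAbs F (K + 1) (k + 1) y'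
  rw [← hy'w, mem_recordWindow_siteOfInt_iff F k (K + 1) R z₀ w hc' hw2'] at hy'
  -- `w` is centred for the SMALL torus too (it lies in the no-reach cube)
  have hwc : ∀ i, 2 * |w i| < ((F.P K).sitesPerDir (k + 1) : ℤ) := fun i => by
    have h1 := hy' i; have h2 := hc i
    have : |w i| ≤ |z₀ i| + R := by
      calc |w i| = |(w i - z₀ i) + z₀ i| := by ring_nf
        _ ≤ |w i - z₀ i| + |z₀ i| := abs_add_le _ _
        _ ≤ R + |z₀ i| := by linarith
        _ = |z₀ i| + R := by ring
    linarith
  refine ⟨siteOfInt F K (k + 1) w, ?_, ?_⟩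
  · rw [mem_recordWindow_siteOfInt_iff F k K R z₀ w hc fun i => (hwc i).le]; exact hy'
  · rw [liftSiteCtr_siteOfInt F K (k + 1) w fun i => mem_Ioc_of_two_mul_abs_lt (hwc i), hy'w]

/-! ## §5  Blocks over the no-wrap window: the centred lift carries `B^{k+1}(y)` onto `B^{k+1}(lift y)` -/

/-- `N_0(K) = L^j · N_j(K)` (standing range). [cite: Balaban1984PropagatorsI, (1.6) p.18 (bookkeeping)] -/
theorem sitesPerDir_zero_eq_pow_mul (K j : ℕ) (hj : j ≤ F.m + K) : ((F.P K).sitesPerDir 0 : ℤ) = (F.L : ℤ) ^ j * (F.P K).sitesPerDir j := by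
  have h := B5Ineq137Torus.pow_mul_sitesPerDir (F.P K) (i := j) (by simpa using hj)
  have h' : ((F.P K).L ^ j * (F.P K).sitesPerDir j : ℕ) = (F.P K).sitesPerDir 0 := h
  rw [← h']; push_cast; simp

/-- Floor division by `M > 0` maps `[−M h, M h]` into `[−h, h]`. [folklore] -/
theorem abs_ediv_le_of_abs_le {z M h : ℤ} (hM : 0 < M) (hz : |z| ≤ M * h) : |z / M| ≤ h := by
  rw [abs_le] at hz ⊢
  constructor
  · have : -h ≤ z / M := by
      rw [Int.le_ediv_iff_mul_le hM]; linarith [hz.1]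
    exact this
  · calc z / M ≤ (M * h) / M := Int.ediv_le_ediv hM hz.2
      _ = h := by rw [mul_comm, Int.mul_ediv_cancel _ hM.ne']

/-- The `(k+1)`-block label of a centred fine label is weakly centred: `2|z_i ∕ L^{k+1}| ≤ N_{k+1}` whenever `2|z_i| ≤ N_0` (standing range).
[cite: Balaban1984PropagatorsI, (1.6) p.18 (bookkeeping)] -/
theorem two_mul_abs_ediv_pow_le (K j : ℕ) (hj : j ≤ F.m + K) {w : ℤ} (hw : 2 * |w| ≤ ((F.P K).sitesPerDir 0 : ℤ)) :
    2 * |w / (F.L : ℤ) ^ j| ≤ ((F.P K).sitesPerDir j : ℤ) := by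
  have hM : (0 : ℤ) < (F.L : ℤ) ^ j := by have := (F.P K).L_pos; positivity
  have hN : ((F.P K).sitesPerDir j : ℤ) = 2 * (F.L : ℤ) ^ (F.m + K - j) := by
    rw [show (F.P K).sitesPerDir j = 2 * F.L ^ (F.m + K - j) from rfl]; push_cast; ring
  have hN0 : ((F.P K).sitesPerDir 0 : ℤ) = (F.L : ℤ) ^ j * (2 * (F.L : ℤ) ^ (F.m + K - j)) := by rw [sitesPerDir_zero_eq_pow_mul F K j hj, hN]
  have hz : |w| ≤ (F.L : ℤ) ^ j * (F.L : ℤ) ^ (F.m + K - j) := by rw [hN0] at hw; linarith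
  have := abs_ediv_le_of_abs_le hM hz
  rw [hN]; linarith

/-- **A FINE LABEL OVER A NO-REACH BLOCK, SHIFTED BY LESS THAN A BLOCK, IS CENTRED**: if `w ∕ L^{k+1} = c` with TWO blocks of margin (`2(|c| + 2) ≤ N_{k+1}`), then
`2|w + s| < N_0` for every `|s| < L^{k+1}` (standing range). [cite: Balaban1987RG1, (1.21) p.264 (bookkeeping)] -/
theorem two_mul_abs_lt_of_ediv_eq (K k : ℕ) (hk : k + 1 ≤ F.m + K) {w c : ℤ} (hwc : w / (F.L : ℤ) ^ (k + 1) = c)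
    (hc : 2 * (|c| + 2) ≤ ((F.P K).sitesPerDir (k + 1) : ℤ)) {s : ℤ} (hs : |s| < (F.L : ℤ) ^ (k + 1)) :
    2 * |w + s| < ((F.P K).sitesPerDir 0 : ℤ) := by
  set M : ℤ := (F.L : ℤ) ^ (k + 1) with hM
  have hM0 : 0 < M := by have := (F.P K).L_pos; positivity
  have hN0 : ((F.P K).sitesPerDir 0 : ℤ) = M * (F.P K).sitesPerDir (k + 1) := sitesPerDir_zero_eq_pow_mul F K (k + 1) hk
  have h1 : c * M ≤ w := by rw [← hwc]; exact Int.ediv_mul_le _ hM0.ne'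
  have h2 : w < c * M + M := by
    have := Int.lt_ediv_add_one_mul_self w hM0
    rw [hwc] at this; linarith
  rw [abs_lt] at hs
  have hws : |w + s| < M * (|c| + 2) := by
    rw [abs_lt]
    rcases abs_cases c with ⟨hca, _⟩ | ⟨hca, _⟩ <;> rw [hca] <;> constructor <;> nlinarith
  have hNc : M * (2 * (|c| + 2)) ≤ ((F.P K).sitesPerDir 0 : ℤ) := by rw [hN0]; exact mul_le_mul_of_nonneg_left hc hM0.le
  linarith

/-- **A FINE LABEL OVER A NO-REACH BLOCK IS CENTRED**: `w ∕ L^{k+1} = c` with `2(|c| + 1) ≤ N_{k+1}` gives `2|w| < N_0` (standing range).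
[cite: Balaban1987RG1, (1.21) p.264 (bookkeeping)] -/
theorem two_mul_abs_lt_of_ediv_eq' (K k : ℕ) (hk : k + 1 ≤ F.m + K) {w c : ℤ} (hwc : w / (F.L : ℤ) ^ (k + 1) = c)
    (hc : 2 * (|c| + 1) ≤ ((F.P K).sitesPerDir (k + 1) : ℤ)) : 2 * |w| < ((F.P K).sitesPerDir 0 : ℤ) := by
  set M : ℤ := (F.L : ℤ) ^ (k + 1) with hM
  have hM0 : 0 < M := by have := (F.P K).L_pos; positivity
  have hN0 : ((F.P K).sitesPerDir 0 : ℤ) = M * (F.P K).sitesPerDir (k + 1) := sitesPerDir_zero_eq_pow_mul F K (k + 1) hk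
  have h1 : c * M ≤ w := by rw [← hwc]; exact Int.ediv_mul_le _ hM0.ne'
  have h2 : w < c * M + M := by
    have := Int.lt_ediv_add_one_mul_self w hM0
    rw [hwc] at this; linarith
  have hws : |w| < M * (|c| + 1) := by
    rw [abs_lt]
    rcases abs_cases c with ⟨hca, _⟩ | ⟨hca, _⟩ <;> rw [hca] <;> constructor <;> nlinarith
  have hNc : M * (2 * (|c| + 1)) ≤ ((F.P K).sitesPerDir 0 : ℤ) := by rw [hN0]; exact mul_le_mul_of_nonneg_left hc hM0.le
  linarith

/-- ★ **THE CENTRED LIFT CARRIES THE BLOCK `B^{k+1}(y)` ONTO `B^{k+1}(lift y)`** for every coarse site `y` of the no-reach cube of radius `R` about `z₀` (`2(|z₀ i| + R + 1) ≤ N_{k+1}`,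
e.g. `y` in the collar of a `NoWrapAt` window). [cite: Balaban1984PropagatorsI, (1.18) p.20; Balaban1987RG1, (1.21) p.264] -/
theorem image_liftSiteCtr_iterBlock (k K R : ℕ) (hk : k + 1 ≤ F.m + K) (z₀ : Fin 4 → ℤ)
    (hc : ∀ i, 2 * (|z₀ i| + R + 1) ≤ ((F.P K).sitesPerDir (k + 1) : ℤ)) {y : Site (F.P K) (k + 1)} (hy : y ∈ recordWindow F k K R z₀) :
    (iterBlock (k + 1) y).image (liftSiteCtr F K 0) = iterBlock (k + 1) (liftSiteCtr F K (k + 1) y) := by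
  classical
  have hkK : k + 1 ≤ (F.P K).m + (F.P K).K := by simpa using hk
  have hkK' : k + 1 ≤ (F.P (K + 1)).m + (F.P (K + 1)).K := by simp only [T4Family.P_m, T4Family.P_K]; omega
  set M : ℤ := (F.L : ℤ) ^ (k + 1) with hM
  have hM0 : 0 < M := by have := (F.P K).L_pos; positivity
  have hle0 : ((F.P K).sitesPerDir 0 : ℤ) ≤ (F.P (K + 1)).sitesPerDir 0 := by exact_mod_cast sitesPerDir_le_succ_vol F K 0 (Nat.zero_le _)
  have hlek : ((F.P K).sitesPerDir (k + 1) : ℤ) ≤ (F.P (K + 1)).sitesPerDir (k + 1) := by exact_mod_cast sitesPerDir_le_succ_vol F K (k + 1) hk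
  -- integer coordinates of `y`
  set c : Fin 4 → ℤ := fun i => ((y (Fin.cast (F.P_d K).symm i)).valMinAbs : ℤ) with hcdef
  have hyc : siteOfInt F K (k + 1) c = y := siteOfInt_valMinAbs F K (k + 1) y
  have hcc : ∀ i, c i * 2 ∈ Set.Ioc (-((F.P K).sitesPerDir (k + 1) : ℤ)) ((F.P K).sitesPerDir (k + 1)) := fun i => valMinAbs_mem_Ioc' F K (k + 1) y _
  have hcR : ∀ i, |c i - z₀ i| ≤ R := by
    have hc' : ∀ i, 2 * (|z₀ i| + R) < ((F.P K).sitesPerDir (k + 1) : ℤ) := fun i => by linarith [hc i]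
    rw [← hyc, mem_recordWindow_siteOfInt_iff F k K R z₀ c hc' fun i => two_mul_abs_valMinAbs_le F K (k + 1) y _] at hy
    exact hy
  have hcb : ∀ i, 2 * (|c i| + 1) ≤ ((F.P K).sitesPerDir (k + 1) : ℤ) := fun i => by
    have : |c i| ≤ |z₀ i| + R := by
      calc |c i| = |(c i - z₀ i) + z₀ i| := by ring_nf
        _ ≤ |c i - z₀ i| + |z₀ i| := abs_add_le _ _
        _ ≤ |z₀ i| + R := by linarith [hcR i]
    linarith [hc i]
  have hly : liftSiteCtr F K (k + 1) y = siteOfInt F (K + 1) (k + 1) c := by rw [← hyc, liftSiteCtr_siteOfInt F K (k + 1) c hcc]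
  ext x'
  simp only [Finset.mem_image, B5Eq118OneStroke.mem_iterBlock]
  constructor
  · rintro ⟨x, hx, rfl⟩
    -- `x = Φ z`, `z ∕ M = c`
    set z : Fin 4 → ℤ := fun i => ((x (Fin.cast (F.P_d K).symm i)).valMinAbs : ℤ) with hzdef
    have hxz : siteOfInt F K 0 z = x := siteOfInt_valMinAbs F K 0 x
    have hzc : ∀ i, z i * 2 ∈ Set.Ioc (-((F.P K).sitesPerDir 0 : ℤ)) ((F.P K).sitesPerDir 0) := fun i => valMinAbs_mem_Ioc' F K 0 x _
    have hzM : (fun i => z i / M) = c := by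
      refine siteOfInt_inj_of_abs_sub_lt F K (k + 1) ?_ fun i => ?_
      · rw [← iterBlockOf_siteOfInt F K (k + 1) hkK z, hxz, hx, hyc]
      · have h1 : 2 * |z i / M| ≤ ((F.P K).sitesPerDir (k + 1) : ℤ) := two_mul_abs_ediv_pow_le F K (k + 1) hk (two_mul_abs_valMinAbs_le F K 0 x _)
        have h2 := hcb i
        have := abs_sub (z i / M) (c i)
        linarith
    rw [← hxz, liftSiteCtr_siteOfInt F K 0 z hzc, iterBlockOf_siteOfInt F (K + 1) (k + 1) hkK' z, hly, hzM]
  · intro hx'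
    set z' : Fin 4 → ℤ := fun i => ((x' (Fin.cast (F.P_d (K + 1)).symm i)).valMinAbs : ℤ) with hz'def
    have hxz' : siteOfInt F (K + 1) 0 z' = x' := siteOfInt_valMinAbs F (K + 1) 0 x'
    have hzM : (fun i => z' i / M) = c := by
      refine siteOfInt_inj_of_abs_sub_lt F (K + 1) (k + 1) ?_ fun i => ?_
      · rw [← iterBlockOf_siteOfInt F (K + 1) (k + 1) hkK' z', hxz', hx', hly]
      · have h1 : 2 * |z' i / M| ≤ ((F.P (K + 1)).sitesPerDir (k + 1) : ℤ) :=
          two_mul_abs_ediv_pow_le F (K + 1) (k + 1) (by omega) (two_mul_abs_valMinAbs_le F (K + 1) 0 x' _)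
        have h2 := hcb i
        have := abs_sub (z' i / M) (c i)
        linarith
    -- `z'` is centred for the SMALL torus: it lies over the no-reach block `c`
    have hz'c : ∀ i, z' i * 2 ∈ Set.Ioc (-((F.P K).sitesPerDir 0 : ℤ)) ((F.P K).sitesPerDir 0) := fun i =>
      mem_Ioc_of_two_mul_abs_lt (two_mul_abs_lt_of_ediv_eq' F K k hk (congrFun hzM i) (hcb i))
    refine ⟨siteOfInt F K 0 z', ?_, ?_⟩
    · rw [iterBlockOf_siteOfInt F K (k + 1) hkK z', hzM, hyc]
    · rw [liftSiteCtr_siteOfInt F K 0 z' hz'c, hxz']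

end Summit.QuantumFields.YangMills.Theorems.PortU8

end
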